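/-
Copyright (c) 2026. All rights reserved.
Released under Apache 2.0 license as described in the file LICENSE.
Authors: abc-iut cell, seat abc-iut-L4-t14 (gen 4; proof-only, consumer side of row «J2-NORMALISER-SLIM»:
the inputs «Λ̄ free of rank ≥ 2» and «C_{N(Λ̄)}(Λ̄) = 1» of the slimness of `N_{PSL₂(ℝ)}(Λ̄)^` for EVERY
finite-index `Λ̄` of a free `Γ̄ ≤ PSL₂(ℝ)` of rank `≥ 2` acting freely on `ℍ`).
-/
import Literature.AnabelianGeometry.AbsoluteAnabelian.ArchimedeanHolFieldFunctorGeometricPSLCentralizer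
import Literature.AnabelianGeometry.AbsoluteAnabelian.ArchimedeanHolFieldFunctorGeometricPSLEA
import Literature.GroupTheory.CombinatorialGroupTheory.SchreierIndexFormulaRank
import Literature.GroupTheory.FreeGroupProfiniteCompletionSlim
import Literature.GroupTheory.FreeNormalSubgroupCompletionSlim
import Mathlib.GroupTheory.FreeGroup.NielsenSchreier
import HarnessLib

/-!
# The objects `Λ̄` of `Loc(PSL₂(ℝ), Γ̄)` for `Γ̄` free of rank `≥ 2`: free of rank `≥ 2`, centraliser-free

S. Mochizuki, *Topics in absolute anabelian geometry III*, proof of Prop 4.2 (i) p. 106 l. 14–19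
(kurims `paper:url-5493eb38cbb7`; bib key `MochizukiAbsTopIII2015`), «the id-rigidity of `EA` follows
immediately from the slimness assertion of Lemma 4.3».  At the uniformised holomorphic model
(abc-iut-L4-t14 gen 3: `HolRS.isIdRigid_EA_mapsTo_pslQuotient`, p440736) the slimness is needed for
`N_{PSL₂(ℝ)}(Λ̄)^` for EVERY finite-index `Λ̄ ≤ Γ̄` (`Λ̄ : LocObj Γ̄`); the group-theoretic theorem
(row «J2-NORMALISER-SLIM», abc-iut-L4-d1) takes as inputs «`Λ̄` free of rank `≥ 2`» and
«`C_{N(Λ̄)}(Λ̄) = 1`».  This PROOF-ONLY file (no definition, no named fact) supplies both inputs for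
every object from the same data on `Γ̄` alone:

* `HolRS.LocObj.exists_mulEquiv_freeGroup` — if `Γ̄` is free with finitely many, `≥ 2`, free
  generators then every `Λ̄ : LocObj Γ̄` is `≃* FreeGroup (Fin m)` with `2 ≤ m` (Nielsen–Schreier,
  Mathlib `subgroupIsFreeOfIsFree`, + the tree's Schreier index formula
  `IsFreeGroup.card_generators_add_index`, Lyndon–Schupp I.3.9);
* `HolRS.LocObj.exists_mul_ne_mul` — hence `Λ̄` is non-abelian;
* `HolRS.LocObj.centralizer_subgroupOf_normalizer_eq_bot` — hence, `Γ̄` acting freely on `ℍ`,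
  `C_{N(Λ̄)}(Λ̄) = 1` in `N(Λ̄) = N_{PSL₂(ℝ)}(Λ̄)` (`HolRS.psl_centralizer_subgroupOf_normalizer_eq_bot`).

PART 2 (appended): with abc-iut-L4-d1's `Literature.GroupTheory.isSlimGroup_completion_normalizer` (row
«J2-NORMALISER-SLIM», p448081) the slimness of `N(Λ̄)^` is PROVED for every object, and the hypothesis
`hslim` of abc-iut-L4-t14's p440098 / p440736 theorems is discharged:
`HolRS.isIdRigid_EA_mapsTo_pslQuotient_of_isFreeGroup`, `HolRS.cor_4_5_geometric_mapsTo_pslQuotient_of_isFreeGroup`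
— hypotheses {`hfin`, `[N(Λ̄) : Λ̄] < ∞`, `Γ̄` free of rank `≥ 2`} only.

Classical; MODEL side of [AbsTopIII] §4 only; nothing here bears on [IUTchIII] Cor. 3.12; model ≠
reconstruction; typed ≠ proved.
-/

set_option autoImplicit false

noncomputable section

open scoped UpperHalfPlane MatrixGroups

namespace Literature.AnabelianGeometry.AbsoluteAnabelian

namespace HolRS

namespace LocObj

open Literature.GroupTheory.CombinatorialGroupTheory (IsFreeGroup.card_generators_add_index)

variable {Γ : Subgroup PSL2R}

/-- **Every object `Λ̄` of `Loc(PSL₂(ℝ), Γ̄)` is free of rank `≥ 2`** when `Γ̄` is free on finitely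
many, `≥ 2`, generators: `Λ̄` has finite index in `Γ̄`, so it is free (Nielsen–Schreier) of rank
`[Γ̄ : Λ̄](r - 1) + 1 ≥ 2` (Schreier). [cite: LyndonSchupp2001, Ch. I Prop. 3.9] -/
theorem exists_mulEquiv_freeGroup [IsFreeGroup Γ] [Finite (IsFreeGroup.Generators Γ)]
    (h2 : 2 ≤ Nat.card (IsFreeGroup.Generators Γ)) (Λ : _root_.Literature.AnabelianGeometry.AbsoluteAnabelian.LocObj Γ) :
    ∃ m : ℕ, 2 ≤ m ∧ Nonempty (Λ.toSubgroup ≃* FreeGroup (Fin m)) := by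
  let K : Subgroup Γ := Λ.toSubgroup.subgroupOf Γ
  haveI : K.FiniteIndex := Λ.finiteIndex
  have hSch := IsFreeGroup.card_generators_add_index K
  have hidx : 1 ≤ K.index := Nat.one_le_iff_ne_zero.mpr Subgroup.FiniteIndex.index_ne_zero
  have h2K : 2 ≤ Nat.card (IsFreeGroup.Generators K) := by
    have : K.index * 2 ≤ K.index * Nat.card (IsFreeGroup.Generators Γ) := Nat.mul_le_mul_left _ h2
    omega
  haveI : Finite (IsFreeGroup.Generators K) := Nat.finite_of_card_ne_zero (by omega)
  let eK : K ≃* Λ.toSubgroup := Subgroup.subgroupOfEquivOfLe Λ.le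
  let e : Λ.toSubgroup ≃* FreeGroup (Fin (Nat.card (IsFreeGroup.Generators K))) :=
    eK.symm.trans ((IsFreeGroup.toFreeGroup K).trans
      (FreeGroup.freeGroupCongr (Finite.equivFin (IsFreeGroup.Generators K))))
  exact ⟨_, h2K, ⟨e⟩⟩

/-- Hence **every `Λ̄ : LocObj Γ̄` is non-abelian**. [cite: LyndonSchupp2001, Ch. I Prop. 3.9] -/
theorem exists_mul_ne_mul [IsFreeGroup Γ] [Finite (IsFreeGroup.Generators Γ)]
    (h2 : 2 ≤ Nat.card (IsFreeGroup.Generators Γ)) (Λ : _root_.Literature.AnabelianGeometry.AbsoluteAnabelian.LocObj Γ) :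
    ∃ x y : Λ.toSubgroup, x * y ≠ y * x := by
  obtain ⟨m, hm, ⟨e⟩⟩ := exists_mulEquiv_freeGroup h2 Λ
  exact Literature.GroupTheory.exists_mul_ne_mul_of_mulEquiv e
    (Literature.GroupTheory.FreeGroup.exists_mul_ne_mul_fin hm)

/-- ★ **`C_{N(Λ̄)}(Λ̄) = 1` for every object `Λ̄` of `Loc(PSL₂(ℝ), Γ̄)`**, `Γ̄` free of rank `≥ 2` acting
freely on `ℍ` (`Λ̄ ≤ Γ̄` acts freely too, and is non-abelian): the `hZ` input of the slimness of
`N_{PSL₂(ℝ)}(Λ̄)^` = [AbsTopIII] Lemma 4.3 for the orbicurve `[ (ℍ/Λ̄) / Aut(ℍ/Λ̄) ]`, for every object at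
once. [cite: MochizukiAbsTopIII2015, Proposition 4.2 (i) proof p.106] -/
theorem centralizer_subgroupOf_normalizer_eq_bot [IsCancelSMul Γ ℍ] [IsFreeGroup Γ]
    [Finite (IsFreeGroup.Generators Γ)] (h2 : 2 ≤ Nat.card (IsFreeGroup.Generators Γ))
    (Λ : _root_.Literature.AnabelianGeometry.AbsoluteAnabelian.LocObj Γ) :
    Subgroup.centralizer
        ((Λ.toSubgroup.subgroupOf (Subgroup.normalizer (Λ.toSubgroup : Set PSL2R)) :
          Set (Subgroup.normalizer (Λ.toSubgroup : Set PSL2R)))) = ⊥ := by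
  haveI : IsCancelSMul Λ.toSubgroup ℍ := isCancelSMul_of_le upperHalfPlane Γ Λ.le
  exact psl_centralizer_subgroupOf_normalizer_eq_bot Λ.toSubgroup (exists_mul_ne_mul h2 Λ)

/-- The same for `Γ̄` itself (the object `⊤`): **`C_{N(Γ̄)}(Γ̄) = 1`**.
[cite: MochizukiAbsTopIII2015, Proposition 4.2 (i) proof p.106] -/
theorem centralizer_subgroupOf_normalizer_eq_bot_self (Γ : Subgroup PSL2R) [IsCancelSMul Γ ℍ]
    [IsFreeGroup Γ] [Finite (IsFreeGroup.Generators Γ)]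
    (h2 : 2 ≤ Nat.card (IsFreeGroup.Generators Γ)) :
    Subgroup.centralizer
        ((Γ.subgroupOf (Subgroup.normalizer (Γ : Set PSL2R)) :
          Set (Subgroup.normalizer (Γ : Set PSL2R)))) = ⊥ :=
  centralizer_subgroupOf_normalizer_eq_bot h2
    ⟨Γ, le_rfl, by rw [Subgroup.subgroupOf_self]; infer_instance⟩

end LocObj

end HolRS

/-! ### Part 2 — the slimness of `N(Λ̄)^` bound BY NAME (abc-iut-L4-d1, row «J2-NORMALISER-SLIM»)

abc-iut-L4-d1's `Literature.GroupTheory.isSlimGroup_completion_normalizer` /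
`eq_one_of_forall_commute_etaFn_normalizer` (p448081, over `eq_one_of_forall_commute_toCompletion`):
for `Γ ≤ N` free, of finite index in `N_N(Γ)`, with `∀ g ∈ N_N(Γ), (∀ γ ∈ Γ, gγ = γg) → g = 1`, the
profinite completion of `N_N(Γ)` is SLIM.  With part 1 (every `Λ̄ : LocObj Γ̄` is free of rank `≥ 2`) and
`HolRS.psl_centralizer_eq_bot` (p447262) both inputs hold for EVERY object, so the hypothesis `hslim` of
abc-iut-L4-t14's p440098/p440736 theorems is DISCHARGED: the geometric column of [AbsTopIII]
Prop 4.2 (i) / Cor 4.5 over `X₀ = ℍ/Γ̄` holds with hypotheses {`hfin`, `hN : [N(Λ̄) : Λ̄] < ∞`,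
`Γ̄` free of rank `≥ 2`} only. -/

namespace HolRS

open _root_.CategoryTheory
open _root_.ProfiniteGrp.ProfiniteCompletion (completion etaFn)
open Literature.AlgebraicGeometry.Frobenioids (IsSlimGroup)

/-- For `Λ̄ ≤ PSL₂(ℝ)` non-abelian acting freely on `ℍ`: the `hC` shape of abc-iut-L4-d1's theorems —
every `g ∈ N(Λ̄)` commuting with `Λ̄` is trivial (`psl_centralizer_eq_bot`).
[cite: MochizukiAbsTopIII2015, Proposition 4.2 (i) proof p.106] -/
theorem forall_mem_normalizer_comm_eq_one (Λ : Subgroup PSL2R) [IsCancelSMul Λ ℍ]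
    (hΛ : ∃ x y : Λ, x * y ≠ y * x) :
    ∀ g ∈ Subgroup.normalizer (Λ : Set PSL2R), (∀ γ ∈ Λ, g * γ = γ * g) → g = 1 := by
  intro g _ hg
  have hmem : g ∈ Subgroup.centralizer (Λ : Set PSL2R) := by
    rw [Subgroup.mem_centralizer_iff]
    exact fun h hh => (hg h hh).symm
  rwa [psl_centralizer_eq_bot Λ hΛ, Subgroup.mem_bot] at hmem

namespace LocObj

variable {Γ : Subgroup PSL2R}

/-- ★ **`N(Λ̄)^` is SLIM for every object `Λ̄` of `Loc(PSL₂(ℝ), Γ̄)`**, `Γ̄` free of rank `≥ 2` acting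
freely on `ℍ`, `[N(Λ̄) : Λ̄] < ∞` — print's «slimness assertion of Lemma 4.3» for
`Π_{[(ℍ/Λ̄)/Aut(ℍ/Λ̄)]} = N_{PSL₂(ℝ)}(Λ̄)^`, by abc-iut-L4-d1's `isSlimGroup_completion_normalizer` with
part 1's inputs (`Λ̄` free: `exists_mulEquiv_freeGroup`; centraliser: `psl_centralizer_eq_bot`).
[cite: MochizukiAbsTopIII2015, Lemma 4.3 p.106] -/
theorem isSlimGroup_completion_normalizer_of_isFreeGroup [IsCancelSMul Γ ℍ] [IsFreeGroup Γ]
    [Finite (IsFreeGroup.Generators Γ)] (h2 : 2 ≤ Nat.card (IsFreeGroup.Generators Γ))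
    (Λ : _root_.Literature.AnabelianGeometry.AbsoluteAnabelian.LocObj Γ)
    [(Λ.toSubgroup.subgroupOf (Subgroup.normalizer (Λ.toSubgroup : Set PSL2R))).FiniteIndex] :
    IsSlimGroup (completion (GrpCat.of (Subgroup.normalizer (Λ.toSubgroup : Set PSL2R)))) := by
  obtain ⟨m, -, ⟨e⟩⟩ := exists_mulEquiv_freeGroup h2 Λ
  haveI : IsCancelSMul Λ.toSubgroup ℍ := isCancelSMul_of_le upperHalfPlane Γ Λ.le
  exact Literature.GroupTheory.isSlimGroup_completion_normalizer Λ.toSubgroup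
    (IsFreeGroup.ofMulEquiv e.symm)
    (forall_mem_normalizer_comm_eq_one Λ.toSubgroup (exists_mul_ne_mul h2 Λ))

/-- The centraliser form for every object: every `y ∈ N(Λ̄)^` commuting with `η(Λ̄)` is `1` (the
hypothesis `h` of `isIdRigid_mapsTo_pslQuotient_of_centralizer`, p440098), by abc-iut-L4-d1's
`eq_one_of_forall_commute_etaFn_normalizer`. [cite: MochizukiAbsTopIII2015, Proposition 4.2 (i) proof p.106] -/
theorem forall_comm_eta_eq_one_of_isFreeGroup [IsCancelSMul Γ ℍ] [IsFreeGroup Γ]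
    [Finite (IsFreeGroup.Generators Γ)] (h2 : 2 ≤ Nat.card (IsFreeGroup.Generators Γ))
    (Λ : _root_.Literature.AnabelianGeometry.AbsoluteAnabelian.LocObj Γ)
    [(Λ.toSubgroup.subgroupOf (Subgroup.normalizer (Λ.toSubgroup : Set PSL2R))).FiniteIndex] :
    ∀ y : completion (GrpCat.of (Subgroup.normalizer (Λ.toSubgroup : Set PSL2R))),
      (∀ γ : Subgroup.normalizer (Λ.toSubgroup : Set PSL2R), (γ : PSL2R) ∈ Λ.toSubgroup →
        y * etaFn (GrpCat.of (Subgroup.normalizer (Λ.toSubgroup : Set PSL2R))) γ =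
          etaFn (GrpCat.of (Subgroup.normalizer (Λ.toSubgroup : Set PSL2R))) γ * y) → y = 1 := by
  intro y hy
  obtain ⟨m, -, ⟨e⟩⟩ := exists_mulEquiv_freeGroup h2 Λ
  haveI : IsCancelSMul Λ.toSubgroup ℍ := isCancelSMul_of_le upperHalfPlane Γ Λ.le
  exact Literature.GroupTheory.eq_one_of_forall_commute_etaFn_normalizer Λ.toSubgroup
    (IsFreeGroup.ofMulEquiv e.symm)
    (forall_mem_normalizer_comm_eq_one Λ.toSubgroup (exists_mul_ne_mul h2 Λ)) y hy

end LocObj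

variable (Γ : Subgroup PSL2R) [ProperlyDiscontinuousSMul Γ ℍ] [IsCancelSMul Γ ℍ]
  (hfin : ∀ (g : PSL2R) (Λ₁ Λ₂ : _root_.Literature.AnabelianGeometry.AbsoluteAnabelian.LocObj Γ),
    (∀ x ∈ Λ₁.toSubgroup, g * x * g⁻¹ ∈ Λ₂.toSubgroup) →
    ((Literature.Geometry.Manifold.QuotientManifold.conjSubgroup g Λ₁.toSubgroup).subgroupOf
      Λ₂.toSubgroup).FiniteIndex)

include hfin in
/-- **«Objects of `HolRS` mapping to `ℍ/Γ̄`» is id-rigid for `Γ̄` free of rank `≥ 2`** acting freely and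
properly discontinuously on `ℍ` with `[N(Γ̄) : Γ̄] < ∞` — Prop 4.2 (i) at the uniformised holomorphic
model with the Lemma 4.3 input PROVED (p440098 + `LocObj.isSlimGroup_completion_normalizer_of_isFreeGroup`
at the object `Γ̄` itself). [cite: MochizukiAbsTopIII2015, Proposition 4.2 (i) proof p.106] -/
theorem isIdRigid_mapsTo_pslQuotient_of_isFreeGroup [IsFreeGroup Γ] [Finite (IsFreeGroup.Generators Γ)]
    (h2 : 2 ≤ Nat.card (IsFreeGroup.Generators Γ))
    [(Γ.subgroupOf (Subgroup.normalizer (Γ : Set PSL2R))).FiniteIndex] :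
    IsIdRigid (ObjectProperty.FullSubcategory fun Y : HolRS => Nonempty (Y ⟶ pslQuotient Γ)) :=
  isIdRigid_mapsTo_pslQuotient_of_isSlimGroup Γ hfin
    (LocObj.isSlimGroup_completion_normalizer_of_isFreeGroup h2 ⟨Γ, le_rfl, by
      rw [Subgroup.subgroupOf_self]; infer_instance⟩)

include hfin in
/-- ★ **The geometric `EA` over `X₀ = ℍ/Γ̄` is ID-RIGID for `Γ̄` free of rank `≥ 2`** acting freely and
properly discontinuously on `ℍ`, provided `[N(Λ̄) : Λ̄] < ∞` for every finite-index `Λ̄ ≤ Γ̄`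
([AbsTopIII] Prop 4.2 (i) at the uniformised holomorphic model: p440736 with its slimness hypothesis
DISCHARGED object by object; the finiteness of `Aut(ℍ/Λ̄)` stays a hypothesis).
[cite: MochizukiAbsTopIII2015, Proposition 4.2 (i) proof p.106] -/
theorem isIdRigid_EA_mapsTo_pslQuotient_of_isFreeGroup [IsFreeGroup Γ]
    [Finite (IsFreeGroup.Generators Γ)] (h2 : 2 ≤ Nat.card (IsFreeGroup.Generators Γ))
    (hN : ∀ Λ : _root_.Literature.AnabelianGeometry.AbsoluteAnabelian.LocObj Γ,
      (Λ.toSubgroup.subgroupOf (Subgroup.normalizer (Λ.toSubgroup : Set PSL2R))).FiniteIndex) :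
    IsIdRigid (geometricAutHolFieldFunctor fun Y : HolRS => Nonempty (Y ⟶ pslQuotient Γ)).EA :=
  isIdRigid_EA_mapsTo_pslQuotient Γ hfin hN fun Λ =>
    haveI := hN Λ
    LocObj.isSlimGroup_completion_normalizer_of_isFreeGroup h2 Λ

include hfin in
/-- ★ **[AbsTopIII] Cor 4.5 (i)–(v) for the archimedean log-Frobenius data over the geometric `EA` of
connected Riemann surfaces finite étale over `ℍ/Γ̄`**, `Γ̄` free of rank `≥ 2`, under the single
finiteness hypothesis `[N(Λ̄) : Λ̄] < ∞` (p440736's `cor_4_5_geometric_mapsTo_pslQuotient` with `hslim`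
DISCHARGED). [cite: MochizukiAbsTopIII2015, Corollary 4.5 pp.107–109] -/
theorem cor_4_5_geometric_mapsTo_pslQuotient_of_isFreeGroup [IsFreeGroup Γ]
    [Finite (IsFreeGroup.Generators Γ)] (h2 : 2 ≤ Nat.card (IsFreeGroup.Generators Γ))
    (hN : ∀ Λ : _root_.Literature.AnabelianGeometry.AbsoluteAnabelian.LocObj Γ,
      (Λ.toSubgroup.subgroupOf (Subgroup.normalizer (Λ.toSubgroup : Set PSL2R))).FiniteIndex) :
    Literature.AnabelianGeometry.AbsoluteAnabelian.AbsTopIII.Cor_4_5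
      (archLogFrobeniusData (geometricAutHolFieldFunctor fun Y : HolRS => Nonempty (Y ⟶ pslQuotient Γ)))
      (archTelecoreData (geometricAutHolFieldFunctor fun Y : HolRS => Nonempty (Y ⟶ pslQuotient Γ))) :=
  cor_4_5_geometric_mapsTo_pslQuotient Γ hfin hN fun Λ =>
    haveI := hN Λ
    LocObj.isSlimGroup_completion_normalizer_of_isFreeGroup h2 Λ

end HolRS

end Literature.AnabelianGeometry.AbsoluteAnabelian

end
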